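import Mathlib
import HarnessLib
import Summits.HubbardSuperconductivity.HubbardSuperconductivity.Theorems.KLProgrammeKLRegimeEngineTowerKitUnitsLip
import Summits.HubbardSuperconductivity.HubbardSuperconductivity.Theorems.KLProgrammeKLRegimeEngineTowerLipschitz

/-!
# Route `KLProgramme` — crux K3 ENGINE (stmt-HubbardSuperconductivity-20437), stub (e) proof-input «(e)-D-ROWS», (M7) units: THE KIT IMAGE OF THE DEEP BLOCK-STEP
# DOOR IN DIMENSIONLESS FORM — E1's `kitStepLip_units` applied to the three brackets of `…TwoVolumeLipDoorKit.lipDoor_le_kit`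
# (seat hubbard-kl-k3c4-p1 g24; `--supports` 20437; DROWS-SCOPE-g24 v8 §10.3 (A))

The kit image of the LIP door (`…TwoVolumeLipDoorKit` / `…TwoVolumeLipBornDiffKit`) is, in the transfer rows `a`, far tail `τ`, admissible `Λ` and the ABSOLUTE
profiles `E` (deep input difference), `ND` (global input difference), `NV` (glued coarse input):
`a^{2q−1}(a·S₂(E; NV+ND+E) + a·Λ⁻¹·S_{2Λ}(ND; NV+ND) + τ·S₂(ND; NV+ND))`, `S_{Ct}(ν; μ) = towerFO D κ² ν q + Σ_{n′∈[2,N₀−1]} eΦ^{n′−1}ψ^q towerSLip D τ_kit ν μ n′ q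
+ Ct·ψ^q e·V(μ)(ΦV(μ))^{N₀−1}/(1−ΦV(μ))` (`Φ = eα/κ²`, `ψ = ρ⁻²`, `τ_kit = (e²(κ+ρ))²`).  With every profile in UNITS `(u, K)` — `E m = K·u^m·bE m`,
`ND m = K·u^m·bD m`, `NV m = K·u^m·bV m` (E1's convention, `…EngineTowerBlockIncrWtKitUnits`: `u = 8^J`, `K = 2^{−5J}` at the block's boundary; here free nonzero
reals) — each bracket is `(u^q·K)·Ŝ` with the DIMENSIONLESS arrays and the rescaled constants `(σ̂, τ̂, Φ̂, ψ̂) = (κ²u, τ_kit·u, Φ·K, ψ/u)` (E1's `kitStepLip_units`,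
k3c5-p2 `…KitUnitsLip`), so the whole kit image is `a^{2q−1}(u^q K)(a·Ŝ₂(bE; bV+bD+bE) + aΛ⁻¹·Ŝ_{2Λ}(bD; bV+bD) + τ·Ŝ₂(bD; bV+bD))` — the literal `hstep` right
side of `EngineV8.towerBornDiff_le_law_of_profile_tok` (first bracket: first order + `towerSLip` + `Ct = 2` tail at the block's dimensionless difference array
`bE` and majorant `bV+bD+bE`) plus two brackets destined for the source slot (`Λ⁻¹`, `τ`), before dividing by the born unit.

* `kitStepLip_abs_eq_units_mul` — `kitStepLip_units` multiplied out; `kitStepLip_abs_eq_units_mul₃ / ₂` — the same with the majorant written as the literal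
  sum of three / two unit-form profiles (the shape the model instance produces);
* **`lipKit_abs_eq_units`** — the displayed identity for the whole kit image.

Pure real analysis (identities); nothing about the model is asserted; nothing asserts the (D) rows, stub (e), VL, K3 or superconductivity.
References: BGM 2006 §2.8 (2.83), §3 (3.2)–(3.8) [cite: BenfattoGiulianiMastropietro2006].
-/

noncomputable section

namespace Summit.HubbardSuperconductivity.HubbardSuperconductivity.Theorems.TwoVolumeDefect

set_option linter.dupNamespace false -- summit = problem name (single-conjunct summit), D-0017

open Finset
open Summit.HubbardSuperconductivity.HubbardSuperconductivity.Theorems.EngineV8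

/-- **`kitStepLip_units` multiplied out**: the absolute Lipschitz step right side at unit-form profiles `= (u^p·K)·` the dimensionless one. -/
theorem kitStepLip_abs_eq_units_mul {K u : ℝ} (hK : K ≠ 0) (hu : u ≠ 0) (D : ℕ) (σ τ Φ ψ Ct : ℝ) (bν bμ : ℕ → ℝ) (N p : ℕ) :
    towerFO D σ (fun m => K * (u ^ m * bν m)) p +
        ∑ n ∈ Icc 2 N, Real.exp 1 * Φ ^ (n - 1) * ψ ^ p * towerSLip D τ (fun m => K * (u ^ m * bν m)) (fun m => K * (u ^ m * bμ m)) n p +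
        Ct * (ψ ^ p * Real.exp 1 * towerV D τ (fun m => K * (u ^ m * bμ m)) * (Φ * towerV D τ (fun m => K * (u ^ m * bμ m))) ^ N /
          (1 - Φ * towerV D τ (fun m => K * (u ^ m * bμ m)))) =
      (u ^ p * K) * (towerFO D (σ * u) bν p + ∑ n ∈ Icc 2 N, Real.exp 1 * (Φ * K) ^ (n - 1) * (ψ / u) ^ p * towerSLip D (τ * u) bν bμ n p +
        Ct * ((ψ / u) ^ p * Real.exp 1 * towerV D (τ * u) bμ * (Φ * K * towerV D (τ * u) bμ) ^ N / (1 - Φ * K * towerV D (τ * u) bμ))) := by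
  have h := kitStepLip_units hK hu D σ τ Φ ψ Ct bν bμ N p
  have hne : u ^ p * K ≠ 0 := mul_ne_zero (pow_ne_zero _ hu) hK
  rw [div_eq_iff hne] at h
  rw [h]; ring

/-- The same with the majorant written as the literal sum of THREE unit-form profiles. -/
theorem kitStepLip_abs_eq_units_mul₃ {K u : ℝ} (hK : K ≠ 0) (hu : u ≠ 0) (D : ℕ) (σ τ Φ ψ Ct : ℝ) (bν b₁ b₂ b₃ : ℕ → ℝ) (N p : ℕ) :
    towerFO D σ (fun m => K * (u ^ m * bν m)) p +
        ∑ n ∈ Icc 2 N, Real.exp 1 * Φ ^ (n - 1) * ψ ^ p *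
          towerSLip D τ (fun m => K * (u ^ m * bν m)) (fun m' => K * (u ^ m' * b₁ m') + K * (u ^ m' * b₂ m') + K * (u ^ m' * b₃ m')) n p +
        Ct * (ψ ^ p * Real.exp 1 * towerV D τ (fun m' => K * (u ^ m' * b₁ m') + K * (u ^ m' * b₂ m') + K * (u ^ m' * b₃ m')) *
          (Φ * towerV D τ (fun m' => K * (u ^ m' * b₁ m') + K * (u ^ m' * b₂ m') + K * (u ^ m' * b₃ m'))) ^ N /
          (1 - Φ * towerV D τ (fun m' => K * (u ^ m' * b₁ m') + K * (u ^ m' * b₂ m') + K * (u ^ m' * b₃ m')))) =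
      (u ^ p * K) * (towerFO D (σ * u) bν p +
        ∑ n ∈ Icc 2 N, Real.exp 1 * (Φ * K) ^ (n - 1) * (ψ / u) ^ p * towerSLip D (τ * u) bν (fun m => b₁ m + b₂ m + b₃ m) n p +
        Ct * ((ψ / u) ^ p * Real.exp 1 * towerV D (τ * u) (fun m => b₁ m + b₂ m + b₃ m) *
          (Φ * K * towerV D (τ * u) (fun m => b₁ m + b₂ m + b₃ m)) ^ N / (1 - Φ * K * towerV D (τ * u) (fun m => b₁ m + b₂ m + b₃ m)))) := by
  have hμ : (fun m' => K * (u ^ m' * b₁ m') + K * (u ^ m' * b₂ m') + K * (u ^ m' * b₃ m')) = fun m => K * (u ^ m * (b₁ m + b₂ m + b₃ m)) :=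
    funext fun m => by ring
  rw [hμ]
  exact kitStepLip_abs_eq_units_mul hK hu D σ τ Φ ψ Ct bν _ N p

/-- The same with the majorant written as the literal sum of TWO unit-form profiles. -/
theorem kitStepLip_abs_eq_units_mul₂ {K u : ℝ} (hK : K ≠ 0) (hu : u ≠ 0) (D : ℕ) (σ τ Φ ψ Ct : ℝ) (bν b₁ b₂ : ℕ → ℝ) (N p : ℕ) :
    towerFO D σ (fun m => K * (u ^ m * bν m)) p +
        ∑ n ∈ Icc 2 N, Real.exp 1 * Φ ^ (n - 1) * ψ ^ p *
          towerSLip D τ (fun m => K * (u ^ m * bν m)) (fun m' => K * (u ^ m' * b₁ m') + K * (u ^ m' * b₂ m')) n p +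
        Ct * (ψ ^ p * Real.exp 1 * towerV D τ (fun m' => K * (u ^ m' * b₁ m') + K * (u ^ m' * b₂ m')) *
          (Φ * towerV D τ (fun m' => K * (u ^ m' * b₁ m') + K * (u ^ m' * b₂ m'))) ^ N /
          (1 - Φ * towerV D τ (fun m' => K * (u ^ m' * b₁ m') + K * (u ^ m' * b₂ m')))) =
      (u ^ p * K) * (towerFO D (σ * u) bν p +
        ∑ n ∈ Icc 2 N, Real.exp 1 * (Φ * K) ^ (n - 1) * (ψ / u) ^ p * towerSLip D (τ * u) bν (fun m => b₁ m + b₂ m) n p +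
        Ct * ((ψ / u) ^ p * Real.exp 1 * towerV D (τ * u) (fun m => b₁ m + b₂ m) *
          (Φ * K * towerV D (τ * u) (fun m => b₁ m + b₂ m)) ^ N / (1 - Φ * K * towerV D (τ * u) (fun m => b₁ m + b₂ m)))) := by
  have hμ : (fun m' => K * (u ^ m' * b₁ m') + K * (u ^ m' * b₂ m')) = fun m => K * (u ^ m * (b₁ m + b₂ m)) := funext fun m => by ring
  rw [hμ]
  exact kitStepLip_abs_eq_units_mul hK hu D σ τ Φ ψ Ct bν _ N p

/-- **THE WHOLE KIT IMAGE OF THE DEEP DOOR IN UNITS** (`K, u ≠ 0`; any `a, τ, Λ, κ, ρ, α`, `D, N₀, q`; unit-form profiles `E = K·u^·bE`, `ND = K·u^·bD`,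
`NV = K·u^·bV`, majorants written as literal sums as the model instance produces them). -/
theorem lipKit_abs_eq_units {K u : ℝ} (hK : K ≠ 0) (hu : u ≠ 0) (κ ρ α Λ a τ : ℝ) (bV bD bE : ℕ → ℝ) (D N₀ q : ℕ) :
      a ^ (2 * q - 1) * (a * (towerFO D (κ ^ 2) (fun m => K * (u ^ m * bE m)) q + Λ⁻¹ * towerFO D (κ ^ 2) (fun m => K * (u ^ m * bD m)) q) + τ * towerFO D (κ ^ 2) (fun m => K * (u ^ m * bD m)) q) +
      a ^ (2 * q - 1) * (a *
        (((∑ n' ∈ Icc 2 (N₀ - 1), Real.exp 1 * (Real.exp 1 * α / κ ^ 2) ^ (n' - 1) * (ρ⁻¹ ^ 2) ^ q *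
              towerSLip D ((Real.exp 2 * (κ + ρ)) ^ 2) (fun m => K * (u ^ m * bE m)) (fun m' => K * (u ^ m' * bV m') + K * (u ^ m' * bD m') + K * (u ^ m' * bE m')) n' q) +
            2 * ((ρ⁻¹ ^ 2) ^ q * Real.exp 1 * towerV D ((Real.exp 2 * (κ + ρ)) ^ 2) (fun m' => K * (u ^ m' * bV m') + K * (u ^ m' * bD m') + K * (u ^ m' * bE m')) *
              (Real.exp 1 * α / κ ^ 2 * towerV D ((Real.exp 2 * (κ + ρ)) ^ 2) (fun m' => K * (u ^ m' * bV m') + K * (u ^ m' * bD m') + K * (u ^ m' * bE m'))) ^ (N₀ - 1) /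
              (1 - Real.exp 1 * α / κ ^ 2 * towerV D ((Real.exp 2 * (κ + ρ)) ^ 2) (fun m' => K * (u ^ m' * bV m') + K * (u ^ m' * bD m') + K * (u ^ m' * bE m'))))) +
          Λ⁻¹ * ((∑ n' ∈ Icc 2 (N₀ - 1), Real.exp 1 * (Real.exp 1 * α / κ ^ 2) ^ (n' - 1) * (ρ⁻¹ ^ 2) ^ q *
              towerSLip D ((Real.exp 2 * (κ + ρ)) ^ 2) (fun m => K * (u ^ m * bD m)) (fun m' => K * (u ^ m' * bV m') + K * (u ^ m' * bD m')) n' q) +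
            (2 * Λ) * ((ρ⁻¹ ^ 2) ^ q * Real.exp 1 * towerV D ((Real.exp 2 * (κ + ρ)) ^ 2) (fun m' => K * (u ^ m' * bV m') + K * (u ^ m' * bD m')) *
              (Real.exp 1 * α / κ ^ 2 * towerV D ((Real.exp 2 * (κ + ρ)) ^ 2) (fun m' => K * (u ^ m' * bV m') + K * (u ^ m' * bD m'))) ^ (N₀ - 1) /
              (1 - Real.exp 1 * α / κ ^ 2 * towerV D ((Real.exp 2 * (κ + ρ)) ^ 2) (fun m' => K * (u ^ m' * bV m') + K * (u ^ m' * bD m')))))) +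
        τ * ((∑ n' ∈ Icc 2 (N₀ - 1), Real.exp 1 * (Real.exp 1 * α / κ ^ 2) ^ (n' - 1) * (ρ⁻¹ ^ 2) ^ q *
              towerSLip D ((Real.exp 2 * (κ + ρ)) ^ 2) (fun m => K * (u ^ m * bD m)) (fun m' => K * (u ^ m' * bV m') + K * (u ^ m' * bD m')) n' q) +
            2 * ((ρ⁻¹ ^ 2) ^ q * Real.exp 1 * towerV D ((Real.exp 2 * (κ + ρ)) ^ 2) (fun m' => K * (u ^ m' * bV m') + K * (u ^ m' * bD m')) *
              (Real.exp 1 * α / κ ^ 2 * towerV D ((Real.exp 2 * (κ + ρ)) ^ 2) (fun m' => K * (u ^ m' * bV m') + K * (u ^ m' * bD m'))) ^ (N₀ - 1) /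
              (1 - Real.exp 1 * α / κ ^ 2 * towerV D ((Real.exp 2 * (κ + ρ)) ^ 2) (fun m' => K * (u ^ m' * bV m') + K * (u ^ m' * bD m')))))) =
      a ^ (2 * q - 1) * (u ^ q * K) *
        (a * (towerFO D (κ ^ 2 * u) bE q +
            (∑ n' ∈ Icc 2 (N₀ - 1), Real.exp 1 * (Real.exp 1 * α / κ ^ 2 * K) ^ (n' - 1) * (ρ⁻¹ ^ 2 / u) ^ q * towerSLip D ((Real.exp 2 * (κ + ρ)) ^ 2 * u) bE (fun m => bV m + bD m + bE m) n' q) +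
            2 * ((ρ⁻¹ ^ 2 / u) ^ q * Real.exp 1 * towerV D ((Real.exp 2 * (κ + ρ)) ^ 2 * u) (fun m => bV m + bD m + bE m) *
              ((Real.exp 1 * α / κ ^ 2 * K) * towerV D ((Real.exp 2 * (κ + ρ)) ^ 2 * u) (fun m => bV m + bD m + bE m)) ^ (N₀ - 1) / (1 - (Real.exp 1 * α / κ ^ 2 * K) * towerV D ((Real.exp 2 * (κ + ρ)) ^ 2 * u) (fun m => bV m + bD m + bE m)))) +
          a * Λ⁻¹ * (towerFO D (κ ^ 2 * u) bD q +
            (∑ n' ∈ Icc 2 (N₀ - 1), Real.exp 1 * (Real.exp 1 * α / κ ^ 2 * K) ^ (n' - 1) * (ρ⁻¹ ^ 2 / u) ^ q * towerSLip D ((Real.exp 2 * (κ + ρ)) ^ 2 * u) bD (fun m => bV m + bD m) n' q) +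
            (2 * Λ) * ((ρ⁻¹ ^ 2 / u) ^ q * Real.exp 1 * towerV D ((Real.exp 2 * (κ + ρ)) ^ 2 * u) (fun m => bV m + bD m) *
              ((Real.exp 1 * α / κ ^ 2 * K) * towerV D ((Real.exp 2 * (κ + ρ)) ^ 2 * u) (fun m => bV m + bD m)) ^ (N₀ - 1) / (1 - (Real.exp 1 * α / κ ^ 2 * K) * towerV D ((Real.exp 2 * (κ + ρ)) ^ 2 * u) (fun m => bV m + bD m)))) +
          τ * (towerFO D (κ ^ 2 * u) bD q +
            (∑ n' ∈ Icc 2 (N₀ - 1), Real.exp 1 * (Real.exp 1 * α / κ ^ 2 * K) ^ (n' - 1) * (ρ⁻¹ ^ 2 / u) ^ q * towerSLip D ((Real.exp 2 * (κ + ρ)) ^ 2 * u) bD (fun m => bV m + bD m) n' q) +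
            2 * ((ρ⁻¹ ^ 2 / u) ^ q * Real.exp 1 * towerV D ((Real.exp 2 * (κ + ρ)) ^ 2 * u) (fun m => bV m + bD m) *
              ((Real.exp 1 * α / κ ^ 2 * K) * towerV D ((Real.exp 2 * (κ + ρ)) ^ 2 * u) (fun m => bV m + bD m)) ^ (N₀ - 1) / (1 - (Real.exp 1 * α / κ ^ 2 * K) * towerV D ((Real.exp 2 * (κ + ρ)) ^ 2 * u) (fun m => bV m + bD m))))) := by
  have e₁ := kitStepLip_abs_eq_units_mul₃ hK hu D (κ ^ 2) ((Real.exp 2 * (κ + ρ)) ^ 2) (Real.exp 1 * α / κ ^ 2) (ρ⁻¹ ^ 2) 2 bE bV bD bE (N₀ - 1) q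
  have e₂ := kitStepLip_abs_eq_units_mul₂ hK hu D (κ ^ 2) ((Real.exp 2 * (κ + ρ)) ^ 2) (Real.exp 1 * α / κ ^ 2) (ρ⁻¹ ^ 2) (2 * Λ) bD bV bD (N₀ - 1) q
  have e₃ := kitStepLip_abs_eq_units_mul₂ hK hu D (κ ^ 2) ((Real.exp 2 * (κ + ρ)) ^ 2) (Real.exp 1 * α / κ ^ 2) (ρ⁻¹ ^ 2) 2 bD bV bD (N₀ - 1) q
  have hre :
      a ^ (2 * q - 1) * (a * (towerFO D (κ ^ 2) (fun m => K * (u ^ m * bE m)) q + Λ⁻¹ * towerFO D (κ ^ 2) (fun m => K * (u ^ m * bD m)) q) + τ * towerFO D (κ ^ 2) (fun m => K * (u ^ m * bD m)) q) +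
      a ^ (2 * q - 1) * (a *
        (((∑ n' ∈ Icc 2 (N₀ - 1), Real.exp 1 * (Real.exp 1 * α / κ ^ 2) ^ (n' - 1) * (ρ⁻¹ ^ 2) ^ q *
              towerSLip D ((Real.exp 2 * (κ + ρ)) ^ 2) (fun m => K * (u ^ m * bE m)) (fun m' => K * (u ^ m' * bV m') + K * (u ^ m' * bD m') + K * (u ^ m' * bE m')) n' q) +
            2 * ((ρ⁻¹ ^ 2) ^ q * Real.exp 1 * towerV D ((Real.exp 2 * (κ + ρ)) ^ 2) (fun m' => K * (u ^ m' * bV m') + K * (u ^ m' * bD m') + K * (u ^ m' * bE m')) *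
              (Real.exp 1 * α / κ ^ 2 * towerV D ((Real.exp 2 * (κ + ρ)) ^ 2) (fun m' => K * (u ^ m' * bV m') + K * (u ^ m' * bD m') + K * (u ^ m' * bE m'))) ^ (N₀ - 1) /
              (1 - Real.exp 1 * α / κ ^ 2 * towerV D ((Real.exp 2 * (κ + ρ)) ^ 2) (fun m' => K * (u ^ m' * bV m') + K * (u ^ m' * bD m') + K * (u ^ m' * bE m'))))) +
          Λ⁻¹ * ((∑ n' ∈ Icc 2 (N₀ - 1), Real.exp 1 * (Real.exp 1 * α / κ ^ 2) ^ (n' - 1) * (ρ⁻¹ ^ 2) ^ q *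
              towerSLip D ((Real.exp 2 * (κ + ρ)) ^ 2) (fun m => K * (u ^ m * bD m)) (fun m' => K * (u ^ m' * bV m') + K * (u ^ m' * bD m')) n' q) +
            (2 * Λ) * ((ρ⁻¹ ^ 2) ^ q * Real.exp 1 * towerV D ((Real.exp 2 * (κ + ρ)) ^ 2) (fun m' => K * (u ^ m' * bV m') + K * (u ^ m' * bD m')) *
              (Real.exp 1 * α / κ ^ 2 * towerV D ((Real.exp 2 * (κ + ρ)) ^ 2) (fun m' => K * (u ^ m' * bV m') + K * (u ^ m' * bD m'))) ^ (N₀ - 1) /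
              (1 - Real.exp 1 * α / κ ^ 2 * towerV D ((Real.exp 2 * (κ + ρ)) ^ 2) (fun m' => K * (u ^ m' * bV m') + K * (u ^ m' * bD m')))))) +
        τ * ((∑ n' ∈ Icc 2 (N₀ - 1), Real.exp 1 * (Real.exp 1 * α / κ ^ 2) ^ (n' - 1) * (ρ⁻¹ ^ 2) ^ q *
              towerSLip D ((Real.exp 2 * (κ + ρ)) ^ 2) (fun m => K * (u ^ m * bD m)) (fun m' => K * (u ^ m' * bV m') + K * (u ^ m' * bD m')) n' q) +
            2 * ((ρ⁻¹ ^ 2) ^ q * Real.exp 1 * towerV D ((Real.exp 2 * (κ + ρ)) ^ 2) (fun m' => K * (u ^ m' * bV m') + K * (u ^ m' * bD m')) *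
              (Real.exp 1 * α / κ ^ 2 * towerV D ((Real.exp 2 * (κ + ρ)) ^ 2) (fun m' => K * (u ^ m' * bV m') + K * (u ^ m' * bD m'))) ^ (N₀ - 1) /
              (1 - Real.exp 1 * α / κ ^ 2 * towerV D ((Real.exp 2 * (κ + ρ)) ^ 2) (fun m' => K * (u ^ m' * bV m') + K * (u ^ m' * bD m')))))) =
      a ^ (2 * q - 1) *
        (a * (towerFO D (κ ^ 2) (fun m => K * (u ^ m * bE m)) q +
            (∑ n' ∈ Icc 2 (N₀ - 1), Real.exp 1 * (Real.exp 1 * α / κ ^ 2) ^ (n' - 1) * (ρ⁻¹ ^ 2) ^ q * towerSLip D ((Real.exp 2 * (κ + ρ)) ^ 2) (fun m => K * (u ^ m * bE m)) (fun m' => K * (u ^ m' * bV m') + K * (u ^ m' * bD m') + K * (u ^ m' * bE m')) n' q) +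
            2 * ((ρ⁻¹ ^ 2) ^ q * Real.exp 1 * towerV D ((Real.exp 2 * (κ + ρ)) ^ 2) (fun m' => K * (u ^ m' * bV m') + K * (u ^ m' * bD m') + K * (u ^ m' * bE m')) *
              ((Real.exp 1 * α / κ ^ 2) * towerV D ((Real.exp 2 * (κ + ρ)) ^ 2) (fun m' => K * (u ^ m' * bV m') + K * (u ^ m' * bD m') + K * (u ^ m' * bE m'))) ^ (N₀ - 1) / (1 - (Real.exp 1 * α / κ ^ 2) * towerV D ((Real.exp 2 * (κ + ρ)) ^ 2) (fun m' => K * (u ^ m' * bV m') + K * (u ^ m' * bD m') + K * (u ^ m' * bE m'))))) +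
          a * Λ⁻¹ * (towerFO D (κ ^ 2) (fun m => K * (u ^ m * bD m)) q +
            (∑ n' ∈ Icc 2 (N₀ - 1), Real.exp 1 * (Real.exp 1 * α / κ ^ 2) ^ (n' - 1) * (ρ⁻¹ ^ 2) ^ q * towerSLip D ((Real.exp 2 * (κ + ρ)) ^ 2) (fun m => K * (u ^ m * bD m)) (fun m' => K * (u ^ m' * bV m') + K * (u ^ m' * bD m')) n' q) +
            (2 * Λ) * ((ρ⁻¹ ^ 2) ^ q * Real.exp 1 * towerV D ((Real.exp 2 * (κ + ρ)) ^ 2) (fun m' => K * (u ^ m' * bV m') + K * (u ^ m' * bD m')) *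
              ((Real.exp 1 * α / κ ^ 2) * towerV D ((Real.exp 2 * (κ + ρ)) ^ 2) (fun m' => K * (u ^ m' * bV m') + K * (u ^ m' * bD m'))) ^ (N₀ - 1) / (1 - (Real.exp 1 * α / κ ^ 2) * towerV D ((Real.exp 2 * (κ + ρ)) ^ 2) (fun m' => K * (u ^ m' * bV m') + K * (u ^ m' * bD m'))))) +
          τ * (towerFO D (κ ^ 2) (fun m => K * (u ^ m * bD m)) q +
            (∑ n' ∈ Icc 2 (N₀ - 1), Real.exp 1 * (Real.exp 1 * α / κ ^ 2) ^ (n' - 1) * (ρ⁻¹ ^ 2) ^ q * towerSLip D ((Real.exp 2 * (κ + ρ)) ^ 2) (fun m => K * (u ^ m * bD m)) (fun m' => K * (u ^ m' * bV m') + K * (u ^ m' * bD m')) n' q) +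
            2 * ((ρ⁻¹ ^ 2) ^ q * Real.exp 1 * towerV D ((Real.exp 2 * (κ + ρ)) ^ 2) (fun m' => K * (u ^ m' * bV m') + K * (u ^ m' * bD m')) *
              ((Real.exp 1 * α / κ ^ 2) * towerV D ((Real.exp 2 * (κ + ρ)) ^ 2) (fun m' => K * (u ^ m' * bV m') + K * (u ^ m' * bD m'))) ^ (N₀ - 1) / (1 - (Real.exp 1 * α / κ ^ 2) * towerV D ((Real.exp 2 * (κ + ρ)) ^ 2) (fun m' => K * (u ^ m' * bV m') + K * (u ^ m' * bD m')))))) := by ring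
  rw [hre, e₁, e₂, e₃]
  ring

end Summit.HubbardSuperconductivity.HubbardSuperconductivity.Theorems.TwoVolumeDefect

end
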